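import Summits.CriticalPhenomena.PercolationContinuityZ3.Theorems.PercFiniteBoxLROLinearScaleLROOfThetaShellCorners
import HarnessLib

/-!
# `PercFiniteBoxLRO.LinearScaleLROOfTheta` (stmt-CriticalPhenomena-0855): Cerf's missing estimate
# follows from "fewer than eight crossing clusters with positive probability" at a LOG-SYNDETIC SET OF
# SCALES, for shells of some fixed aspect ratio, at `p_c(ℤ³)`

Helper file (`--supports stmt-CriticalPhenomena-0855`) of line `registered` (lead c1); the scale-sparse
form of `PercFiniteBoxLROLinearScaleLROOfThetaShellFewAspect.lean`.  Notation as there: `P = P_{p_c}` bond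
percolation on `ℤ³`, shells `Λ_{l(k+1)} ∖ Λ_k` of integer aspect ratio `l ≥ 2`, event `F⁸_{l,k}` = "there
are NO eight sites of `∂ⁱⁿΛ_{k+1}`, each joined inside the shell to `∂ⁱⁿΛ_{l(k+1)}`, pairwise not joined
inside the shell".

**Theorem** (`linearScaleLROOfTheta_of_shellFewPos_syndetic`).  Suppose that for some `l ≥ 2`, `L ≥ 1`,
`δ > 0` and all large `a` there is a GOOD SCALE `k ∈ [a, L a]`, i.e. one with `P_{p_c}(F⁸_{l,k}) ≥ δ`
(the good scales are syndetic on the logarithmic scale — they need not be all scales).  Then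
`LinearScaleLROOfTheta` (Cerf 2015, arXiv:1306.3105, p. 4).

Proof (`criticalFloor_of_shellFewPos_syndetic`): as in the all-scales file, except that the `J` disjoint
good shells inside `Λ_{(K-1)n}` are now chosen greedily — `k_0 ∈ [n, Ln]` good, `k_{j+1} ∈
[l(k_j+1), L l(k_j+1)]` good — so that `k_j ≤ (2lL)^j L n` and `K = 2lL(2lL)^J + 2` suffices.  With
probability `≥ θ⁸/2` the eight corners of `[0,n]³` percolate and are pairwise not joined inside
`Λ_{(K-1)n}` (Harris–FKG, translation invariance, the negation of the critical floor at scale `n`);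
their arms split each chosen shell into `≥ 8` crossing clusters; independence across the disjoint shells
gives `θ⁸/2 ≤ (1-δ)^J`, absurd.  Small scales by AKN pointwise local uniqueness + Cerf's Lemma 10.1;
then the landed `linearScaleLROOfTheta_of_criticalFloor`.

## References

* R. Cerf, Ann. Probab. 43 (2015) 2458–2480, arXiv:1306.3105, p. 4 and §10 [Cerf2015].
* M. Aizenman, Nucl. Phys. B 485 (1997) 551–582 [Aizenman1997].
* G. Grimmett, *Percolation*, 2nd ed. (1999), Thm (2.4), §2.2, §1.6 [GrimmettPercolation1999].
-/

noncomputable section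

namespace Summit.CriticalPhenomena.PercolationContinuityZ3.Theorems

namespace ShellUniq

open Literature.Probability.Percolation Literature.Probability.LatticeModels
open Literature.Probability.Percolation.DCT16 Literature.Probability.Percolation.AKN
open MeasureTheory Filter Set
open scoped Topology ENNReal

/-! ## The reduction -/

set_option maxHeartbeats 400000 in
/-- **"Fewer than eight crossing clusters" with positive probability at a log-syndetic set of scales
⟹ the critical one-site floor.**  If for some `l ≥ 2`, `L ≥ 1`, `δ > 0` and every large `a` some
scale `k ∈ [a, La]` has: with `P_{p_c}`-probability `≥ δ` the shell `Λ_{l(k+1)} ∖ Λ_k` does NOT contain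
eight sites of `∂ⁱⁿΛ_{k+1}`, each joined inside the shell to `∂ⁱⁿΛ_{l(k+1)}`, pairwise not joined
inside the shell, then `θ(p_c) > 0` implies: for some `ρ₀ > 0`, `K ≥ 1` and every `n ≥ 1`, some
`x ∈ ∂ⁱⁿΛ_n` has `P_{p_c}(0 ↔ x inside Λ_{Kn}) ≥ ρ₀`. [cite: Cerf2015, p. 4 and §10] -/
theorem criticalFloor_of_shellFewPos_syndetic
    (hU : ∃ l : ℕ, 2 ≤ l ∧ ∃ L : ℕ, 1 ≤ L ∧ ∃ δ : ℝ, 0 < δ ∧ ∃ a₀ : ℕ, ∀ a : ℕ, a₀ ≤ a →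
      ∃ k : ℕ, a ≤ k ∧ k ≤ L * a ∧
      δ ≤ (bondPercolation (zdGraph 3) (criticalProbI 3)).real {ω : BondConfig (Site 3) |
        ¬ ∃ x : Fin 8 → Site 3, (∀ i, x i ∈ innerBoundary (zdGraph 3) (box 3 (k + 1))) ∧
          (∀ i, ∃ b ∈ innerBoundary (zdGraph 3) (box 3 (l * (k + 1))),
            ω ∈ openConnIn (↑(box 3 (l * (k + 1)) \ box 3 k) : Set (Site 3)) (x i) b) ∧
          ∀ i j, i ≠ j → ω ∉ openConnIn (↑(box 3 (l * (k + 1)) \ box 3 k) : Set (Site 3)) (x i) (x j)})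
    (hθ : 0 < theta (zdGraph 3) (0 : Site 3) (criticalProbI 3)) :
    ∃ ρ₀ : ℝ, 0 < ρ₀ ∧ ∃ K : ℕ, 1 ≤ K ∧ ∀ n : ℕ, 1 ≤ n →
      ∃ x ∈ innerBoundary (zdGraph 3) (box 3 n),
        ρ₀ ≤ (bondPercolation (zdGraph 3) (criticalProbI 3)).real
          (openConnIn (↑(box 3 (K * n)) : Set (Site 3)) (0 : Site 3) x) := by
  classical
  set p : unitInterval := criticalProbI 3 with hp
  set μ := bondPercolation (zdGraph 3) p with hμ
  set θ₀ : ℝ := theta (zdGraph 3) (0 : Site 3) p with hθ₀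
  obtain ⟨l, hl, L, hL, δ, hδ, a₀, ha₀⟩ := hU
  -- the "fewer than eight crossing clusters" events at aspect ratio `l`, as a family
  set U : ℕ → Set (BondConfig (Site 3)) := fun k => {ω : BondConfig (Site 3) |
        ¬ ∃ x : Fin 8 → Site 3, (∀ i, x i ∈ innerBoundary (zdGraph 3) (box 3 (k + 1))) ∧
          (∀ i, ∃ b ∈ innerBoundary (zdGraph 3) (box 3 (l * (k + 1))),
            ω ∈ openConnIn (↑(box 3 (l * (k + 1)) \ box 3 k) : Set (Site 3)) (x i) b) ∧
          ∀ i j, i ≠ j → ω ∉ openConnIn (↑(box 3 (l * (k + 1)) \ box 3 k) : Set (Site 3)) (x i) (x j)}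
    with hUdef
  -- a good scale in every window `[a, La]`, `a ≥ a₀`, as a function
  have hgood : ∀ a, a₀ ≤ a → ∃ k, a ≤ k ∧ k ≤ L * a ∧ δ ≤ μ.real (U k) := fun a ha => ha₀ a ha
  set g : ℕ → ℕ := fun a => if h : a₀ ≤ a then Classical.choose (hgood a h) else a with hg
  have hg_ge : ∀ a, a₀ ≤ a → a ≤ g a := fun a ha => by
    simp only [hg, dif_pos ha]; exact (Classical.choose_spec (hgood a ha)).1
  have hg_le : ∀ a, a₀ ≤ a → g a ≤ L * a := fun a ha => by
    simp only [hg, dif_pos ha]; exact (Classical.choose_spec (hgood a ha)).2.1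
  have hg_good : ∀ a, a₀ ≤ a → δ ≤ μ.real (U (g a)) := fun a ha => by
    simp only [hg, dif_pos ha]; exact (Classical.choose_spec (hgood a ha)).2.2
  have hθ1 : θ₀ ≤ 1 := measureReal_le_one
  have hθ8 : 0 < θ₀ ^ 8 := by positivity
  have hδ1 : δ ≤ 1 := (hg_good a₀ le_rfl).trans measureReal_le_one
  obtain ⟨J, hJ⟩ := exists_pow_lt_of_lt_one (show 0 < θ₀ ^ 8 / 2 by positivity)
    (show 1 - δ < 1 by linarith)
  -- small scales: AKN pointwise local uniqueness at the axis sites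
  set ε : ℝ≥0∞ := ENNReal.ofReal (θ₀ ^ 2 / 4) with hε
  have hεpos : 0 < ε := by rw [hε, ENNReal.ofReal_pos]; positivity
  have hev : ∀ n ∈ Finset.range (a₀ + 1), ∀ᶠ j : ℕ in atTop,
      μ (badPair (n + j) (0 : Site 3) (Pi.single 0 (n : ℤ))) < ε := fun n _ =>
    (tendsto_measure_badPair p (zero_mem_box 3 n) (LinearScaleLROReduction.single_mem_box n)).eventually
      (gt_mem_nhds hεpos)
  obtain ⟨j₀, hj₀⟩ := ((Finset.eventually_all (Finset.range (a₀ + 1))).2 hev).exists_forall_of_atTop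
  -- the box factor: the shells live in `Λ_{(K-1)n}`, one unit of `n` is spent on translations
  set C : ℕ := 2 * l * L * (2 * L * l) ^ J with hC
  set K : ℕ := max (C + 2) (j₀ + 1) with hK
  have hK1 : 1 ≤ K := le_trans (by omega) (le_max_right _ _)
  have hKJ : C + 2 ≤ K := le_max_left _ _
  have hKj : j₀ + 1 ≤ K := le_max_right _ _
  refine ⟨θ₀ ^ 8 / 112, by positivity, K, hK1, fun n hn => ?_⟩
  by_contra hcon
  push Not at hcon
  -- `hcon : ∀ x ∈ ∂ⁱⁿΛ_n, P(0 ↔ x inside Λ_{Kn}) < θ₀⁸/112`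
  set v : Site 3 := Pi.single 0 (n : ℤ) with hv
  have hlt := hcon v (LinearScaleLROReduction.single_mem_innerBoundary n)
  rcases lt_or_ge n (a₀ + 1) with hsmall | hlarge
  · -- small scale `n ≤ a₀`
    obtain ⟨j, hj⟩ : ∃ j, K * n = n + j := Nat.exists_eq_add_of_le (Nat.le_mul_of_pos_left n (by omega))
    have h1 : (j₀ + 1) * n ≤ K * n := Nat.mul_le_mul_right n hKj
    rw [add_mul, one_mul] at h1
    have h2 : j₀ ≤ j₀ * n := Nat.le_mul_of_pos_right j₀ (by omega)
    have hjge : j₀ ≤ j := by omega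
    have hlt' := hj₀ j hjge n (Finset.mem_range.2 hsmall)
    have hreal : μ.real (badPair (n + j) (0 : Site 3) v) ≤ θ₀ ^ 2 / 4 := by
      rw [measureReal_def]
      have h := ENNReal.toReal_mono ENNReal.ofReal_ne_top hlt'.le
      rwa [ENNReal.toReal_ofReal (by positivity)] at h
    have hvbox : v ∈ box 3 (n + j) := box_mono 3 (by omega) (LinearScaleLROReduction.single_mem_box n)
    have h10 := LinearScaleLROReduction.cerf_lemma_10_1 p (zero_mem_box 3 (n + j)) hvbox
    rw [hj] at hlt
    have h82 : θ₀ ^ 8 ≤ θ₀ ^ 2 := pow_le_pow_of_le_one measureReal_nonneg hθ1 (by norm_num)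
    linarith
  · -- large scale: eight corners, the split event, `J` disjoint shells inside `Λ_{(K-1)n}`
    have hn1 : 1 ≤ n := hn
    set R : ℕ := (K - 1) * n with hR
    have hKR : K * n = R + n := by
      rw [hR]; obtain ⟨K', hK'⟩ : ∃ K', K = K' + 1 := ⟨K - 1, by omega⟩
      rw [hK']; simp [add_mul]
    have hnR : n ≤ R := by
      rw [hR]; exact Nat.le_mul_of_pos_left n (by omega)
    -- the good scales, chosen greedily: `k 0 = g n`, `k (j+1) = g (l (k j + 1))`
    have hna : a₀ ≤ n := by omega
    set k : ℕ → ℕ := fun j => Nat.rec (g n) (fun _ s => g (l * (s + 1))) j with hk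
    have hk0 : k 0 = g n := rfl
    have hk_succ : ∀ j, k (j + 1) = g (l * (k j + 1)) := fun j => rfl
    have hk_ge : ∀ j, n ≤ k j ∧ a₀ ≤ l * (k j + 1) := by
      intro j
      induction j with
      | zero =>
        have h0 : n ≤ k 0 := by rw [hk0]; exact hg_ge n hna
        exact ⟨h0, by nlinarith⟩
      | succ j ih =>
        have h1 : l * (k j + 1) ≤ k (j + 1) := by rw [hk_succ j]; exact hg_ge _ ih.2
        have h2 : n ≤ k (j + 1) := by nlinarith [ih.1]
        exact ⟨h2, by nlinarith⟩
    have hnk : ∀ j, n ≤ k j := fun j => (hk_ge j).1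
    have hk_step : ∀ j, l * (k j + 1) ≤ k (j + 1) := fun j => by
      rw [hk_succ j]; exact hg_ge _ (hk_ge j).2
    have hk_mono : ∀ i j, i ≤ j → k i ≤ k j := by
      intro i j hij
      induction hij with
      | refl => exact le_rfl
      | @step j _ ih => exact ih.trans (by nlinarith [hk_step j])
    have hk_good : ∀ j, δ ≤ μ.real (U (k j)) := by
      intro j
      cases j with
      | zero => rw [hk0]; exact hg_good n hna
      | succ j => rw [hk_succ j]; exact hg_good _ (hk_ge j).2
    have hk_bound : ∀ j, k j ≤ (2 * L * l) ^ j * (L * n) := by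
      intro j
      induction j with
      | zero => rw [hk0, pow_zero, one_mul]; exact hg_le n hna
      | succ j ih =>
        rw [hk_succ j]
        have h1 : g (l * (k j + 1)) ≤ L * (l * (k j + 1)) := hg_le _ (hk_ge j).2
        have h2 : k j + 1 ≤ 2 * k j := by have := hnk j; omega
        calc g (l * (k j + 1)) ≤ L * (l * (k j + 1)) := h1
          _ ≤ L * (l * (2 * k j)) := by gcongr
          _ = (2 * L * l) * k j := by ring
          _ ≤ (2 * L * l) * ((2 * L * l) ^ j * (L * n)) := Nat.mul_le_mul_left _ ih
          _ = (2 * L * l) ^ (j + 1) * (L * n) := by rw [pow_succ]; ring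
    set q : ℕ → ℕ := fun j => l * (k j + 1) - 1 with hq
    have hlm1 : ∀ j, 1 ≤ l * (k j + 1) := fun j =>
      Nat.one_le_iff_ne_zero.2 (Nat.mul_ne_zero (by omega) (by omega))
    have hq1 : ∀ j, q j + 1 = l * (k j + 1) := fun j => Nat.sub_add_cancel (hlm1 j)
    have hkq : ∀ j, k j < q j := fun j => by
      have h1 : k j + 1 + (k j + 1) ≤ l * (k j + 1) := by nlinarith
      have h3 := hq1 j
      omega
    -- shells with `j < J` fit inside `Λ_R`
    have hfit : ∀ j, j < J → q j + 1 ≤ R := fun j hj => by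
      rw [hq1 j, hR]
      have hb := hk_bound j
      have hpow : (2 * L * l) ^ j ≤ (2 * L * l) ^ J :=
        Nat.pow_le_pow_right (Nat.one_le_iff_ne_zero.2 (by positivity)) hj.le
      have h2 : k j + 1 ≤ 2 * k j := by have := hnk j; omega
      have hK' : C ≤ K - 1 := by omega
      calc l * (k j + 1) ≤ l * (2 * k j) := Nat.mul_le_mul_left l h2
        _ ≤ l * (2 * ((2 * L * l) ^ j * (L * n))) := by gcongr
        _ ≤ l * (2 * ((2 * L * l) ^ J * (L * n))) := by gcongr
        _ = C * n := by rw [hC]; ring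
        _ ≤ (K - 1) * n := Nat.mul_le_mul_right n hK'
    -- disjointness of the shells
    set F : ℕ → Finset (Sym2 (Site 3)) := fun j => (box 3 (l * (k j + 1)) \ box 3 (k j)).sym2 with hF
    have hshell_disj : ∀ i j, i < j → Disjoint (box 3 (l * (k i + 1)) \ box 3 (k i))
        (box 3 (l * (k j + 1)) \ box 3 (k j)) := by
      intro i j hij
      rw [Finset.disjoint_left]
      intro z hzi hzj
      rw [Finset.mem_sdiff] at hzi hzj
      apply hzj.2
      refine box_mono 3 ?_ hzi.1
      exact (hk_step i).trans (hk_mono (i + 1) j hij)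
    have hFdisj : ∀ i j, i < j → j < J → Disjoint (F i) (F j) := by
      intro i j hij _
      rw [Finset.disjoint_left]
      intro e hei hej
      induction e using Sym2.ind with
      | h x y =>
        rw [hF, Finset.mk_mem_sym2_iff] at hei hej
        exact Finset.disjoint_left.1 (hshell_disj i j hij) hei.1 hej.1
    -- corners and their pairwise non-connections inside `Λ_R`
    set c : (Fin 3 → Bool) → Site 3 := fun s i => if s i then (n : ℤ) else 0 with hc
    have hcbox : ∀ s, c s ∈ box 3 n := fun s => corner_mem_box n s
    have hpair : ∀ s s', s ≠ s' →
        μ.real (openConnIn (↑(box 3 R) : Set (Site 3)) (c s) (c s')) < θ₀ ^ 8 / 112 := by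
      intro s s' hss'
      refine real_openConnIn_lt_of_translate p (B := K * n) (by omega) (hcbox s)
        (box_mono 3 hnR (hcbox s)) ?_
      exact hcon _ (corner_sub_mem_innerBoundary n hss')
    -- the split event `E`: all corners percolate, no two are joined inside `Λ_R`
    set T : Finset (Site 3) := Finset.univ.image c with hT
    set Pairs : Finset ((Fin 3 → Bool) × (Fin 3 → Bool)) := Finset.univ.filter fun ss => ss.1 ≠ ss.2
      with hPairs
    set E : Set (BondConfig (Site 3)) := (⋂ z ∈ T, percolatesAt z) \
      ⋃ ss ∈ Pairs, openConnIn (↑(box 3 R) : Set (Site 3)) (c ss.1) (c ss.2) with hE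
    have hcinj : Function.Injective c := by
      intro s s' hss'
      by_contra hne
      have h : c s' - c s ∈ innerBoundary (zdGraph 3) (box 3 n) := corner_sub_mem_innerBoundary n hne
      rw [hss', sub_self] at h
      have := (mem_innerBoundary_iff.1 h).2
      obtain ⟨y, hy, hy0⟩ := this
      apply hy
      have := mem_box_succ_of_adj (zero_mem_box 3 0) hy0
      exact box_mono 3 hn1 this
    have hTcard : T.card = 8 := by
      rw [hT, Finset.card_image_of_injective _ hcinj, Finset.card_univ, Fintype.card_fun,
        Fintype.card_bool, Fintype.card_fin]
      norm_num
    have hPcard : (Pairs.card : ℝ) ≤ 56 := by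
      have : Pairs.card ≤ (Finset.univ : Finset ((Fin 3 → Bool) × (Fin 3 → Bool))).card :=
        Finset.card_filter_le _ _
      rw [Finset.card_univ, Fintype.card_prod, Fintype.card_fun, Fintype.card_bool, Fintype.card_fin] at this
      have h64 : Pairs.card ≤ 56 := by
        -- the diagonal has 8 elements
        have hdiag : (Finset.univ.filter fun ss : (Fin 3 → Bool) × (Fin 3 → Bool) => ¬ ss.1 ≠ ss.2).card = 8 := by
          have : (Finset.univ.filter fun ss : (Fin 3 → Bool) × (Fin 3 → Bool) => ¬ ss.1 ≠ ss.2) =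
              (Finset.univ : Finset (Fin 3 → Bool)).image fun s => (s, s) := by
            ext ss
            simp only [ne_eq, not_not, Finset.mem_filter, Finset.mem_univ, true_and, Finset.mem_image]
            constructor
            · intro h; exact ⟨ss.1, Prod.ext rfl h⟩
            · rintro ⟨s, rfl⟩; rfl
          rw [this, Finset.card_image_of_injective _ fun s s' h => (Prod.ext_iff.1 h).1, Finset.card_univ,
            Fintype.card_fun, Fintype.card_bool, Fintype.card_fin]
          norm_num
        have hsum := Finset.card_filter_add_card_filter_not
          (s := (Finset.univ : Finset ((Fin 3 → Bool) × (Fin 3 → Bool)))) (fun ss => ss.1 ≠ ss.2)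
        rw [Finset.card_univ, Fintype.card_prod, Fintype.card_fun, Fintype.card_bool, Fintype.card_fin,
          hdiag] at hsum
        rw [hPairs]
        omega
      exact_mod_cast h64
    have hEge : θ₀ ^ 8 / 2 ≤ μ.real E := by
      have hI : θ₀ ^ 8 ≤ μ.real (⋂ z ∈ T, percolatesAt z) := by
        have h := pow_card_le_real_biInter_percolatesAt p T
        rwa [hTcard] at h
      have hUnion : μ.real (⋃ ss ∈ Pairs, openConnIn (↑(box 3 R) : Set (Site 3)) (c ss.1) (c ss.2)) ≤
          Pairs.card * (θ₀ ^ 8 / 112) := by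
        refine (measureReal_biUnion_finset_le Pairs _).trans ?_
        have : ∀ ss ∈ Pairs, μ.real (openConnIn (↑(box 3 R) : Set (Site 3)) (c ss.1) (c ss.2)) ≤ θ₀ ^ 8 / 112 :=
          fun ss hss => (hpair ss.1 ss.2 (Finset.mem_filter.1 hss).2).le
        calc ∑ ss ∈ Pairs, μ.real (openConnIn (↑(box 3 R) : Set (Site 3)) (c ss.1) (c ss.2))
            ≤ ∑ _ss ∈ Pairs, θ₀ ^ 8 / 112 := Finset.sum_le_sum this
          _ = Pairs.card * (θ₀ ^ 8 / 112) := by rw [Finset.sum_const, nsmul_eq_mul]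
      have hdiff : μ.real (⋂ z ∈ T, percolatesAt z) ≤ μ.real E +
          μ.real (⋃ ss ∈ Pairs, openConnIn (↑(box 3 R) : Set (Site 3)) (c ss.1) (c ss.2)) := by
        refine (measureReal_mono ?_).trans (measureReal_union_le _ _)
        intro ω hω
        by_cases hc' : ω ∈ ⋃ ss ∈ Pairs, openConnIn (↑(box 3 R) : Set (Site 3)) (c ss.1) (c ss.2)
        · exact Or.inr hc'
        · exact Or.inl ⟨hω, hc'⟩
      have hU' : μ.real (⋃ ss ∈ Pairs, openConnIn (↑(box 3 R) : Set (Site 3)) (c ss.1) (c ss.2)) ≤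
          56 * (θ₀ ^ 8 / 112) :=
        hUnion.trans (mul_le_mul_of_nonneg_right hPcard (by positivity))
      linarith
    -- an enumeration of the eight corners
    have hcard8 : Fintype.card (Fin 3 → Bool) = 8 := by
      rw [Fintype.card_fun, Fintype.card_bool, Fintype.card_fin]; norm_num
    set e : Fin 8 ≃ (Fin 3 → Bool) := (Fintype.equivFinOfCardEq hcard8).symm with he
    -- on the split event every "fewer than eight" event `U (k j)`, `j < J`, fails
    have hEsub : μ.real E ≤ μ.real (⋂ j ∈ Finset.range J, (U (k j))ᶜ) := by
      refine real_mono_of_forall_subset_edgeSet (zdGraph 3) p fun ω hω hωE => ?_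
      simp only [Set.mem_iInter, Finset.mem_range]
      intro j hj
      obtain ⟨hperc, hnc⟩ := hωE
      -- arms of the corners and their shell segments
      have hpz : ∀ s, ω ∈ percolatesAt (c s) := by
        intro s
        have : ω ∈ ⋂ z ∈ T, percolatesAt z := hperc
        rw [Set.mem_iInter₂] at this
        exact this (c s) (by rw [hT]; exact Finset.mem_image_of_mem c (Finset.mem_univ s))
      have hseg : ∀ s, ∃ a ∈ innerBoundary (zdGraph 3) (box 3 (k j + 1)),
          ∃ b ∈ innerBoundary (zdGraph 3) (box 3 (q j + 1)),
            ω ∈ openConnIn (↑(box 3 (q j + 1) \ box 3 (k j)) : Set (Site 3)) a b ∧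
              ω ∈ openConnIn (↑(box 3 R) : Set (Site 3)) (c s) a := by
        intro s
        obtain ⟨w, hw, hcw⟩ := toBdry_of_percolatesAt (box_mono 3 hnR (hcbox s)) hω (hpz s)
        have hqR : q j < R := by have := hfit j hj; omega
        exact shell_segment_gen (hkq j) hω (box_mono 3 (hnk j) (hcbox s))
          (notMem_box_of_mem_innerBoundary_box hqR hw) hcw
      choose a ha b hb hab hca using hseg
      have hnoconn : ∀ s s', s ≠ s' →
          ω ∉ openConnIn (↑(box 3 (q j + 1) \ box 3 (k j)) : Set (Site 3)) (a s) (a s') := by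
        intro s s' hss' hss
        apply hnc
        rw [Set.mem_iUnion₂]
        refine ⟨(s, s'), Finset.mem_filter.2 ⟨Finset.mem_univ _, hss'⟩, ?_⟩
        have hsub : (↑(box 3 (q j + 1) \ box 3 (k j)) : Set (Site 3)) ⊆ ↑(box 3 R) := by
          rw [Finset.coe_sdiff]
          rintro z ⟨hz, -⟩
          exact Finset.coe_subset.2 (box_mono 3 (hfit j hj)) hz
        have h1 : ω ∈ openConnIn (↑(box 3 R) : Set (Site 3)) (a s') (c s') := by
          have := hca s'
          rw [mem_openConnIn_iff_pathIn] at this ⊢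
          exact this.symm
        exact openConnIn_trans' (openConnIn_trans' (hca s) (openConnIn_mono' hsub hss)) h1
      -- the witness: eight pairwise non-joined crossings
      simp only [hUdef, Set.mem_compl_iff, Set.mem_setOf_eq, not_not]
      refine ⟨fun i => a (e i), fun i => ha (e i), fun i => ?_, fun i i' hii' => ?_⟩
      · have h := hb (e i); have h' := hab (e i)
        rw [hq1 j] at h h'
        exact ⟨b (e i), h, h'⟩
      · have h := hnoconn (e i) (e i') (fun heq => hii' (e.injective heq))
        rwa [hq1 j] at h
    -- independence: the failures have probability `≤ (1-δ)^J`
    have hdet : ∀ j, DeterminedBy (U (k j)) (↑(F j) : Set (Sym2 (Site 3))) := fun j => by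
      rw [determinedBy_iff]
      intro ω ω' hωω'
      have key : ∀ x y : Site 3,
          ω ∈ openConnIn (↑(box 3 (l * (k j + 1)) \ box 3 (k j)) : Set (Site 3)) x y ↔
            ω' ∈ openConnIn (↑(box 3 (l * (k j + 1)) \ box 3 (k j)) : Set (Site 3)) x y := fun x y =>
        (determinedBy_iff _ _).1 (determinedBy_openConnIn
          (↑(box 3 (l * (k j + 1)) \ box 3 (k j)) : Set (Site 3)) x y
          (K := (↑((box 3 (l * (k j + 1)) \ box 3 (k j)).sym2) : Set (Sym2 (Site 3))))
          (by rw [Finset.coe_sym2])) ω ω' hωω'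
      simp only [hUdef, Set.mem_setOf_eq, key]
    have hpow : μ.real (⋂ j ∈ Finset.range J, (U (k j))ᶜ) ≤ (1 - δ) ^ J := by
      refine real_biInter_le_pow p (A := fun j => (U (k j))ᶜ) (F := F) (fun j => ?_) hFdisj
        (by linarith) fun j hj => ?_
      · have h := hdet j
        rw [determinedBy_iff] at h ⊢
        intro ω ω' hωω'
        rw [Set.mem_compl_iff, Set.mem_compl_iff, h ω ω' hωω']
      · have hmeas : MeasurableSet (U (k j)) := (hdet j).measurableSet_of_finset
        rw [measureReal_compl hmeas, probReal_univ]
        linarith [hk_good j]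
    linarith

end ShellUniq

open Literature.Probability.Percolation Literature.Probability.LatticeModels MeasureTheory

/-- **"Fewer than eight crossing clusters" with positive probability at a log-syndetic set of
scales, for shells of SOME fixed aspect ratio at `p_c(ℤ³)`, implies Cerf's missing estimate `X_D`.**
Hypothesis (OPEN; θ-free, hyperscaling type, scale-sparse form): there are integers `l ≥ 2`, `L ≥ 1`,
`δ > 0` and `a₀` such that every window `[a, La]`, `a ≥ a₀`, contains a scale `k` at which, with
`P_{p_c}`-probability at least `δ`, there are NO eight sites of `∂ⁱⁿΛ_{k+1}`, each joined inside the
shell `Λ_{l(k+1)} ∖ Λ_k` to `∂ⁱⁿΛ_{l(k+1)}`, pairwise not joined inside that shell.  Conclusion: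
`LinearScaleLROOfTheta`.  Proof: `ShellUniq.criticalFloor_of_shellFewPos_syndetic` and the landed
`linearScaleLROOfTheta_of_criticalFloor`. [cite: Cerf2015, p. 4 and §10] -/
theorem linearScaleLROOfTheta_of_shellFewPos_syndetic :
    (∃ l : ℕ, 2 ≤ l ∧ ∃ L : ℕ, 1 ≤ L ∧ ∃ δ : ℝ, 0 < δ ∧ ∃ a₀ : ℕ, ∀ a : ℕ, a₀ ≤ a →
      ∃ k : ℕ, a ≤ k ∧ k ≤ L * a ∧
      δ ≤ (bondPercolation (zdGraph 3) (criticalProbI 3)).real {ω : BondConfig (Site 3) |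
        ¬ ∃ x : Fin 8 → Site 3, (∀ i, x i ∈ innerBoundary (zdGraph 3) (box 3 (k + 1))) ∧
          (∀ i, ∃ b ∈ innerBoundary (zdGraph 3) (box 3 (l * (k + 1))),
            ω ∈ openConnIn (↑(box 3 (l * (k + 1)) \ box 3 k) : Set (Site 3)) (x i) b) ∧
          ∀ i j, i ≠ j → ω ∉ openConnIn (↑(box 3 (l * (k + 1)) \ box 3 k) : Set (Site 3)) (x i) (x j)}) →
    Summit.CriticalPhenomena.PercolationContinuityZ3.Theses.PercFiniteBoxLRO.LinearScaleLROOfTheta :=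
  fun hU => linearScaleLROOfTheta_of_criticalFloor (ShellUniq.criticalFloor_of_shellFewPos_syndetic hU)

end Summit.CriticalPhenomena.PercolationContinuityZ3.Theorems

end
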